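import Literature.NumberTheory.EllipticCurves.BSDAnalyticRank
import Literature.NumberTheory.EllipticCurves.Selmer
import Mathlib.Analysis.SpecialFunctions.Pow.Real
import Mathlib.Topology.Algebra.InfiniteSum.Basic
import HarnessLib

/-!
# Heath-Brown 1994 (Invent. Math. 118), *The size of Selmer groups for the congruent number problem, II*: Theorem 1 (all moments of `2^{s(D)}`) and Theorem 2 (the limiting distribution of the `2`-Selmer rank `s(D)` of `E_D : y² = x³ − D²x`) AS PRINTED

HONEST FRAMING (cell `bsd-print-cf2`, D-0131 (2) PRINT TIER, typer seat `ty1`; HOME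
`run/shared/lean/pub/bsd-print-cf2/`): PUBLISHED theorems vendored as named `Prop`s (nothing
asserted, nothing discharged; D-0014), every printed hypothesis a binder, locators into the held
text. These two theorems are the headline of a paper named in the cell's charter (prover p2's
"Heath-Brown / Monsky matrices" sentence); they are DISTRIBUTIONAL statements about the `2`-Selmer
rank of the congruent number curves (`j = 1728`, CM by `ℤ[i]`) over the odd square-free `D` in a
residue class mod `8`, AT the prime `2` but certifying NO individual curve and carrying NO
Birch–Swinnerton-Dyer content. (They are the "Theorem 14" ingredient — density `2λ = 0.8388…` of
`{s(D) = 1}` — of Tian's ICM 2022 survey Thm. 8.) The companion file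
`HeathBrown1994/CongruentTwoSelmerMonskyMatrix.lean` holds Monsky's appendix (the exact value of
`#Sel₂(E_D)` per `D`); this file adds the paper's own Theorems 1–2. Nothing is booked here.

Source. D. R. Heath-Brown, *The size of Selmer groups for the congruent number problem, II*,
Invent. Math. **118** (1994) 331–370, doi:10.1007/bf01231536 [HeathBrown1994SelmerCongruentII]
(PUBLISHED, refereed). Text read: the held OA typescript `paper:heathbrown1994-size-selmer-
groups-congruent-number-problem-ii` (42 pp.; `pNNNN` = typescript page; §1 = pp. 1–8).

## The printed statements (verbatim, typescript pp. 1–3)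

* Set-up (p. 1 L8–L26): "`E_D : y² = x³ − D²x` (1) … we shall, restrict attention to square-free
  numbers `D`. … The number of `2`-descents is the order of the Selmer group `S^{(2)}`. This is a
  power of `2`, and will be a multiple of `4`, on account of the rational points of order `2` on
  `E_D`. We shall therefore write `#S^{(2)} = 2^{2+s(D)}`. … `S(X, h) = {1 ≤ D ≤ X; D ≡ h (mod 8),
  D odd and square-free}`."
* **Theorem 1** (p. 2 L3–L11): "For `h = 1, 3, 5` or `7`, and any fixed positive integer `k` we have
  `∑_{D ∈ S(X,h)} 2^{k s(D)} = c_k #S(X, h) + o_k(X)` as `X → ∞`, where `c_k = ∏_{j=1}^{k} (1 + 2^j)`."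
* **Theorem 2** (p. 2 L16–L30): "Let `λ = ∏_{n=1}^{∞} (1 + 2^{−n})^{−1} = ∏_{n=0}^{∞} (1 − 2^{−2n−1})
  = 0.4194…`, and `d_r = λ · 2^r / ∏_{1 ≤ j ≤ r} (2^j − 1)` (`r = 0, 1, 2, …`). Then if `h = 1` or `3`,
  and `r` is even, or if `h = 5` or `7`, and `r` is odd, we have
  `#{D ∈ S(X, h) : s(D) = r} ∼ d_r #S(X, h)`, as `X → ∞`."
* Parity (p. 3 L10–L12): "`s(D) ≡ 0 (mod 2)` for `D ≡ 1` or `3 (mod 8)`, `s(D) ≡ 1 (mod 2)` for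
  `D ≡ 5` or `7 (mod 8)`" (Monsky's appendix; tree `HeathBrown1994/CongruentTwoSelmerMonskyMatrix`).
* Corollary 1 (p. 3 L29–L32): "`#{D ∈ S(X,h); s(D) ≥ r}/#S(X,h) ≤ 1.7313… × 2^{−(r²−r)/2} + o(1)`";
  Corollaries 2–4 (mean values `c′ = 1.2039…`, `c″ = 1.3250…`; the same bounds for the rank
  `r(D) ≤ s(D)`) — recorded, not typed.

## Transcription (tree dictionary)

* `E_D` = the tree's `congruentNumberCurve D : y² = x³ − D²x` (`BSDAnalyticRank`), literally;
  `S^{(2)}` = the tree's `2`-Selmer group over `ℚ`, `WeierstrassCurve.selmerGroup (congruentNumberCurve D) 2`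
  (`Selmer.lean`; the same object as in `HeathBrown1994.monsky_card_selmerGroup_two_odd` and
  `Smith2016.cor13_bsd_of_selmerRankTwo`).
* "`#S^{(2)} = 2^{2+s(D)}`": `selmerRankTwo D := log₂ #S^{(2)}(E_D) − 2` (a definition with body;
  `Nat.log`, `Nat.card`; for square-free `D` the Selmer group is finite of order `2^{2+s}`, so this IS
  the printed `s(D)`; junk otherwise, never used).
* `S(X, h)` = `hbSet X h` := `{D ∈ [1, X] : D % 8 = h ∧ Squarefree D}` as a `Finset ℕ` (for odd `h`
  the congruence makes `D` odd); `X` runs through `ℕ` (the counting functions only change at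
  integers, so `X → ∞` through `ℕ` is the printed limit).
* Theorem 1's "`= c_k #S(X,h) + o_k(X)`": `(∑_{D ∈ S(X,h)} 2^{k s(D)} − c_k #S(X,h)) / X → 0`.
* Theorem 2's "`#{…} ∼ d_r #S(X,h)`": `#{D ∈ S(X,h) : s(D) = r} / #S(X,h) → d_r` (`d_r > 0` and
  `#S(X,h) → ∞`, so this is the printed asymptotic equivalence); `λ` as the convergent infinite
  product `∏' n, (1 + 2^{−(n+1)})⁻¹` over `n : ℕ` (Mathlib `tprod`), `d_r` literally.
No `_holds` is expected (Heath-Brown's character-sum / linked-variables analysis of §§2–7).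
Consumers take `(h : thm1_moments_two_pow_selmerRank)` etc.

## References
* [HeathBrown1994SelmerCongruentII] D. R. Heath-Brown, Invent. Math. 118 (1994) 331–370:
  §1 (typescript pp. 1–4: set-up, Thm. 1, Thm. 2, parity, Cor. 1–4), §8 (proof of Thm. 2).
* [Tian2023CongruentICM] Y. Tian, Proc. ICM 2022, Thm. 14 (the density `0.8388… = d₁` of
  `{s(n) = 1}`), Thm. 8.
-/

noncomputable section

open scoped Classical Topology

open Filter WeierstrassCurve Literature.NumberTheory.EllipticCurves

namespace Literature.NumberTheory.EllipticCurves.HeathBrown1994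

/-! ### §1. Vocabulary (definitions with bodies; nothing asserted) -/

/-- **Heath-Brown's `2`-Selmer rank `s(D)`** of `E_D : y² = x³ − D²x` (p. 1): "The number of
`2`-descents is the order of the Selmer group `S^{(2)}`. This is a power of `2`, and will be a
multiple of `4` … We shall therefore write `#S^{(2)} = 2^{2+s(D)}`", rendered as
`log₂ #Sel₂(E_D/ℚ) − 2` with the tree's `2`-Selmer group over `ℚ`.
[cite: HeathBrown1994SelmerCongruentII, §1 (typescript p. 1 L14–L19)] -/
def selmerRankTwo (D : ℕ) : ℕ :=
  Nat.log 2 (Nat.card ((congruentNumberCurve D).selmerGroup 2)) - 2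

/-- Unfolding of `selmerRankTwo`. [cite: HeathBrown1994SelmerCongruentII, §1 (typescript p. 1 L14–L19)] -/
theorem selmerRankTwo_def (D : ℕ) :
    selmerRankTwo D = Nat.log 2 (Nat.card ((congruentNumberCurve D).selmerGroup 2)) - 2 :=
  rfl

/-- **`S(X, h) = {1 ≤ D ≤ X ; D ≡ h (mod 8), D odd and square-free}`** (p. 1 L25–L26), as a finite
set of natural numbers (for the odd residues `h = 1, 3, 5, 7` of the theorems the congruence forces
`D` odd). [cite: HeathBrown1994SelmerCongruentII, §1 (typescript p. 1 L25–L26)] -/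
def hbSet (X h : ℕ) : Finset ℕ :=
  (Finset.Icc 1 X).filter fun D ↦ D % 8 = h ∧ Squarefree D

/-- Unfolding of `hbSet`. [cite: HeathBrown1994SelmerCongruentII, §1 (typescript p. 1 L25–L26)] -/
theorem hbSet_def (X h : ℕ) :
    hbSet X h = (Finset.Icc 1 X).filter fun D ↦ D % 8 = h ∧ Squarefree D :=
  rfl

/-- **`c_k = ∏_{j=1}^{k} (1 + 2^j)`** (Thm. 1). [cite: HeathBrown1994SelmerCongruentII, Thm. 1 (typescript p. 2 L8–L11)] -/
def momentConst (k : ℕ) : ℝ :=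
  ∏ j ∈ Finset.Icc 1 k, (1 + (2 : ℝ) ^ j)

/-- **`λ = ∏_{n=1}^{∞} (1 + 2^{−n})^{−1} = 0.4194…`** (Thm. 2), as the infinite product over
`n + 1`, `n : ℕ`. [cite: HeathBrown1994SelmerCongruentII, Thm. 2 (typescript p. 2 L17–L23)] -/
def lambdaHB : ℝ :=
  ∏' n : ℕ, (1 + (2 : ℝ) ^ (-((n : ℝ) + 1)))⁻¹

/-- **`d_r = λ · 2^r / ∏_{1 ≤ j ≤ r} (2^j − 1)`** (Thm. 2; `r = 0, 1, 2, …`; `d₀ = λ`, `d₁ = 2λ =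
0.8388…`). [cite: HeathBrown1994SelmerCongruentII, Thm. 2 (typescript p. 2 L25–L27)] -/
def limitFreq (r : ℕ) : ℝ :=
  lambdaHB * (2 : ℝ) ^ r / ∏ j ∈ Finset.Icc 1 r, ((2 : ℝ) ^ j - 1)

/-! ### §2. The printed theorems (named facts; nothing asserted) -/

/-- **Heath-Brown 1994, Theorem 1** (verbatim in the module docstring): "For `h = 1, 3, 5` or `7`,
and any fixed positive integer `k` we have `∑_{D ∈ S(X,h)} 2^{k s(D)} = c_k #S(X, h) + o_k(X)` as
`X → ∞`, where `c_k = ∏_{j=1}^{k} (1 + 2^j)`." Transcription (module docstring):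
`(∑_{D ∈ hbSet X h} 2^{k · s(D)} − c_k · #hbSet X h) / X → 0` along `X → ∞` in `ℕ`, with
`s = selmerRankTwo`. DISTRIBUTIONAL; no individual curve is certified. PUBLISHED (refereed).
[cite: HeathBrown1994SelmerCongruentII, Thm. 1 (typescript p. 2 L3–L11)] -/
def thm1_moments_two_pow_selmerRank : Prop :=
  ∀ (h : ℕ), (h = 1 ∨ h = 3 ∨ h = 5 ∨ h = 7) → ∀ (k : ℕ), 0 < k →
    Tendsto
      (fun X : ℕ ↦
        ((∑ D ∈ hbSet X h, (2 : ℝ) ^ (k * selmerRankTwo D)) -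
            momentConst k * ((hbSet X h).card : ℝ)) / (X : ℝ))
      atTop (𝓝 0)

/-- **Heath-Brown 1994, Theorem 2** (verbatim in the module docstring): "Let
`λ = ∏_{1}^{∞} (1 + 2^{−n})^{−1} = ∏_{0}^{∞} (1 − 2^{−2n−1}) = 0.4194…`, and
`d_r = λ 2^r / ∏_{1 ≤ j ≤ r} (2^j − 1)` (`r = 0, 1, 2, …`). Then if `h = 1` or `3`, and `r` is even,
or if `h = 5` or `7`, and `r` is odd, we have `#{D ∈ S(X, h) : s(D) = r} ∼ d_r #S(X, h)`, as
`X → ∞`." Transcription (module docstring): the proportion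
`#{D ∈ hbSet X h : selmerRankTwo D = r} / #hbSet X h → limitFreq r` (`d_r > 0`, so this is the
printed `∼`). (For the complementary parities the count is `0` by the parity theorem — Monsky's
appendix, tree `HeathBrown1994/CongruentTwoSelmerMonskyMatrix.lean` — and is not part of this
statement.) DISTRIBUTIONAL. PUBLISHED (refereed).
[cite: HeathBrown1994SelmerCongruentII, Thm. 2 (typescript p. 2 L16–L30), §8 (proof)] -/
def thm2_selmerRank_distribution : Prop :=
  ∀ (h r : ℕ), ((h = 1 ∨ h = 3) ∧ Even r) ∨ ((h = 5 ∨ h = 7) ∧ Odd r) →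
    Tendsto
      (fun X : ℕ ↦
        (((hbSet X h).filter fun D ↦ selmerRankTwo D = r).card : ℝ) / ((hbSet X h).card : ℝ))
      atTop (𝓝 (limitFreq r))

end Literature.NumberTheory.EllipticCurves.HeathBrown1994
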